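import Summits.CriticalPhenomena.PercolationContinuityZ3.Theorems.PercNearOneGluingNoHeavyQuantFarEarHairArith
import Summits.CriticalPhenomena.PercolationContinuityZ3.Theorems.PercNearOneGluingNoHeavyQuantFarEarHairArithCover
import HarnessLib

/-!
# QUANT lane R8, front "FAR beyond trees", layer one — THE HAIRED EAR AT THE OBSERVER, VIII: the bookkeeping inequality (decision tree)

builds on p205010 (kernel theorem, internal audit signed; external expert review pending)

Support file (`--supports stmt-CriticalPhenomena-4575`), seat `prim-quant-p1` (gen 27); memo
`run/shared/lean/prim/quant/prim-quant-p1-g27/FOR-LEAD-HAIR.md` §2–§3.  Pure real arithmetic; standard axioms; no sorries; no definitions.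

**THE BOOKKEEPING INEQUALITY** of the haired ear at the observer (notation of `…EarHairArith`): for cells `x₀₀,…,d₂ ≥ 0` of total mass
`1`, `g = c + d₁ + d₂`, Harris `g·(a₁ + a₂ + d₁ + d₂) ≤ d₁ + d₂`, outside sum `N x ≤ S ≤ S_ub`, threshold `x ≤ q_v, q_h` and mean
`q_v + q_h + S > 2`, one has `x ≤ P`.
* `EarHair.arith_master_two` — `N ≥ 2` outside relays: decision tree `A₁ ≥ 0 → M0`; `D < 0 → M1`; `L₁, L₂ ≥ 0 → M4`; else `M3`
  (the branches are valid by `…EarHairArithCover`);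
* `EarHair.arith_master_one` — one outside relay (the cells `a₂, d₂` are empty): `A₁ ≥ 0 → M0`; `L₁, L₂ ≥ 0 → M4`; else `M3′`
  (`g < 1`) or the corner certificate (`g = 1`).
The pure-bookkeeping version (without the Harris row) is FALSE for small `p` (memo §1: pseudo-laws at `p ≲ 0.04`, `N ≥ 5`), which is why
the `a₁`-deficit of regime M0 is paid by Harris' inequality in M4.  [this work]
-/

namespace Summit.CriticalPhenomena.PercolationContinuityZ3.Theorems

namespace Quant

namespace EarHair

/-- **The bookkeeping inequality, `N ≥ 2` outside relays.** [this work] -/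
theorem arith_master_two {p r s W N x S g x00 x01 a1 a2 c d1 d2 P qv qh Sub : ℝ}
    (hp0 : 0 ≤ p) (hp1 : p ≤ 1) (hr0 : 0 ≤ r) (hr1 : r ≤ 1) (hs0 : 0 ≤ s) (hs1 : s ≤ 1)
    (hW : W = (1 - p) * (1 - r)) (hN : 2 ≤ N)
    (hx00 : 0 ≤ x00) (hx01 : 0 ≤ x01) (ha1 : 0 ≤ a1) (ha2 : 0 ≤ a2) (hc : 0 ≤ c) (hd1 : 0 ≤ d1) (hd2 : 0 ≤ d2)
    (hone : x00 + x01 + a1 + a2 + c + d1 + d2 = 1) (hg : g = c + d1 + d2)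
    (hP : P = p * r * s * x00 + p * r * x01 + p * a1 + a2 + (1 - W) * s * c + (1 - W * (1 - s)) * d1 + d2)
    (hqv : qv = p + (1 - p) * r * g) (hqh : qh = s * (p * r + (1 - p * r) * g))
    (hSubd : Sub = p * r * N * x01 + (1 - p * r + p * r * N) * a1 + N * a2 + d1 + N * d2)
    (hHar : g * (a1 + a2 + d1 + d2) ≤ d1 + d2)
    (hxv : x ≤ qv) (hxh : x ≤ qh) (hSx : N * x ≤ S) (hSub : S ≤ Sub) (hEN : 2 < qv + qh + S) : x ≤ P := by
  have hW0 : 0 ≤ W := by rw [hW]; exact mul_nonneg (by linarith) (by linarith)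
  have hW1 : W ≤ 1 := by rw [hW]; nlinarith
  have hN0 : 0 < N := by linarith
  have hg0 : 0 ≤ g := by rw [hg]; linarith
  have hg1 : g ≤ 1 := by rw [hg]; linarith
  have hPhi : 0 ≤ 1 - s + s * W := by nlinarith
  by_cases hA1 : 0 ≤ N * p * ((1 - W) * (1 - r * s) + W * (1 - r)) - W * (1 - p * r)
  · -- regime M0
    exact arith_M0 hp0 hp1 hr0 hr1 hs0 hs1 hW hW0 hW1 hN0 hx00 hx01 ha1 ha2 hd1 hd2 hone hg hP hqh hSubd hA1
      (cover_A2_of_A1 hp0 hp1 hr0 hr1 hs0 hs1 hW (by linarith) hA1) hxh hSx hSub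
  have hA1' : N * p * ((1 - W) * (1 - r * s) + W * (1 - r)) - W * (1 - p * r) < 0 := lt_of_not_ge hA1
  by_cases hD : (N - 1) * (1 - s + s * W) - N * (1 - s) * W < 0
  · -- regime M1
    obtain ⟨hLam, hB1, hB2, hB3, hB4, hB5⟩ := cover_B_of_D hp0 hp1 hr0 hr1 hs0 hs1 hW hN hD
    exact arith_M1 hp0 hp1 hr0 hr1 hs0 hs1 hW hW0 hLam hx00 hx01 ha1 ha2 hd1 hd2 hone hg hP hqv hqh hSubd hB1 hB2 hB3 hB4 hB5
      hxh hSub hEN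
  have hD' : 0 ≤ (N - 1) * (1 - s + s * W) - N * (1 - s) * W := le_of_not_gt hD
  by_cases hL : 0 ≤ g * (N * ((1 - W) ^ 2 * (1 - s) + W * (1 - W * (1 - s))) - W) +
        (N * p * ((1 - W) * (1 - r * s) + W * (1 - r)) - W * (1 - p * r)) * (1 - g) ∧
      0 ≤ N * g * (1 - W) * (1 - s) + (N * p * ((1 - W) * (1 - r * s) + W * (1 - r)) - W * (1 - p * r)) * (1 - g)
  · -- regime M4 (`g > 0` since `L₂ ≥ 0` and `A₁ < 0`)
    have hgp : 0 < g := by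
      by_contra hc0
      have hgz : g = 0 := le_antisymm (le_of_not_gt hc0) hg0
      have h2 := hL.2
      rw [hgz] at h2
      nlinarith
    exact arith_M4 hp0 hp1 hr0 hr1 hs0 hs1 hW hW0 hW1 hN0 hx00 hx01 ha2 hd1 hd2 hone hg hgp hP hqh hSubd hA1'.le hL.1 hL.2 hHar
      hxh hSx hSub
  · -- regime M3 (`g < 1` since `g = 1` would satisfy `L₁, L₂ ≥ 0` by `cover_A2_of_D`)
    have hL' : g * (N * ((1 - W) ^ 2 * (1 - s) + W * (1 - W * (1 - s))) - W) +
          (N * p * ((1 - W) * (1 - r * s) + W * (1 - r)) - W * (1 - p * r)) * (1 - g) < 0 ∨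
        N * g * (1 - W) * (1 - s) + (N * p * ((1 - W) * (1 - r * s) + W * (1 - r)) - W * (1 - p * r)) * (1 - g) < 0 := by
      rcases not_and_or.mp hL with h | h
      · exact Or.inl (lt_of_not_ge h)
      · exact Or.inr (lt_of_not_ge h)
    have hglt : g < 1 := by
      by_contra hc1
      have hg1' : g = 1 := le_antisymm hg1 (le_of_not_gt hc1)
      obtain ⟨-, hA2⟩ := cover_A2_of_D hp0 hp1 hr0 hr1 hs0 hs1 hW hN hD'
      apply hL
      rw [hg1']
      refine ⟨by linarith, ?_⟩
      have : 0 ≤ N * 1 * (1 - W) * (1 - s) := mul_nonneg (mul_nonneg (by linarith) (by linarith)) (by linarith)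
      linarith
    obtain ⟨hY00, hY01, hYA1, hYA2⟩ := cover_Y hp0 hp1 hr0 hr1 hs0 hs1 hW hN hg0 hg1 hA1' hL'
    exact arith_M3 hW hN0 hx00 hx01 ha1 ha2 hd1 hone hg hglt hP hqv hqh hSubd hPhi hY00 hY01 hYA1 hYA2 hD' hxv hSub hEN

/-- **The bookkeeping inequality, one outside relay** (the cells `a₂ = d₂` are empty). [this work] -/
theorem arith_master_one {p r s W x S g x00 x01 a1 c d1 P qv qh Sub : ℝ}
    (hp0 : 0 ≤ p) (hp1 : p ≤ 1) (hr0 : 0 ≤ r) (hr1 : r ≤ 1) (hs0 : 0 ≤ s) (hs1 : s ≤ 1)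
    (hW : W = (1 - p) * (1 - r))
    (hx00 : 0 ≤ x00) (hx01 : 0 ≤ x01) (ha1 : 0 ≤ a1) (hc : 0 ≤ c) (hd1 : 0 ≤ d1)
    (hone : x00 + x01 + a1 + c + d1 = 1) (hg : g = c + d1)
    (hP : P = p * r * s * x00 + p * r * x01 + p * a1 + (1 - W) * s * c + (1 - W * (1 - s)) * d1)
    (hqv : qv = p + (1 - p) * r * g) (hqh : qh = s * (p * r + (1 - p * r) * g)) (hSubd : Sub = p * r * x01 + a1 + d1)
    (hHar : g * (a1 + d1) ≤ d1)
    (hxv : x ≤ qv) (hxh : x ≤ qh) (hSx : x ≤ S) (hSub : S ≤ Sub) (hEN : 2 < qv + qh + S) : x ≤ P := by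
  have hW0 : 0 ≤ W := by rw [hW]; exact mul_nonneg (by linarith) (by linarith)
  have hW1 : W ≤ 1 := by rw [hW]; nlinarith
  have hg0 : 0 ≤ g := by rw [hg]; linarith
  have hg1 : g ≤ 1 := by rw [hg]; linarith
  -- the seven-cell bookkeeping data with `a₂ = d₂ = 0`, `N = 1`
  have hone7 : x00 + x01 + a1 + 0 + c + d1 + 0 = 1 := by rw [← hone]; ring
  have hg7 : g = c + d1 + 0 := by rw [hg]; ring
  have hP7 : P = p * r * s * x00 + p * r * x01 + p * a1 + 0 + (1 - W) * s * c + (1 - W * (1 - s)) * d1 + 0 := by rw [hP]; ring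
  have hSubd7 : Sub = p * r * 1 * x01 + (1 - p * r + p * r * 1) * a1 + 1 * 0 + d1 + 1 * 0 := by rw [hSubd]; ring
  have hSx7 : 1 * x ≤ S := by linarith
  have hHar7 : g * (a1 + 0 + d1 + 0) ≤ d1 + 0 := by simpa using hHar
  by_cases hA1 : 0 ≤ 1 * p * ((1 - W) * (1 - r * s) + W * (1 - r)) - W * (1 - p * r)
  · exact arith_M0 hp0 hp1 hr0 hr1 hs0 hs1 hW hW0 hW1 one_pos hx00 hx01 ha1 le_rfl hd1 le_rfl hone7 hg7 hP7 hqh hSubd7 hA1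
      (cover_A2_of_A1 hp0 hp1 hr0 hr1 hs0 hs1 hW le_rfl hA1) hxh hSx7 hSub
  have hA1' : 1 * p * ((1 - W) * (1 - r * s) + W * (1 - r)) - W * (1 - p * r) < 0 := lt_of_not_ge hA1
  by_cases hL : 0 ≤ g * (1 * ((1 - W) ^ 2 * (1 - s) + W * (1 - W * (1 - s))) - W) +
        (1 * p * ((1 - W) * (1 - r * s) + W * (1 - r)) - W * (1 - p * r)) * (1 - g) ∧
      0 ≤ 1 * g * (1 - W) * (1 - s) + (1 * p * ((1 - W) * (1 - r * s) + W * (1 - r)) - W * (1 - p * r)) * (1 - g)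
  · have hgp : 0 < g := by
      by_contra hc0
      have hgz : g = 0 := le_antisymm (le_of_not_gt hc0) hg0
      have h2 := hL.2
      rw [hgz] at h2
      nlinarith
    exact arith_M4 hp0 hp1 hr0 hr1 hs0 hs1 hW hW0 hW1 one_pos hx00 hx01 le_rfl hd1 le_rfl hone7 hg7 hgp hP7 hqh hSubd7 hA1'.le
      hL.1 hL.2 hHar7 hxh hSx7 hSub
  · -- `L₁ < 0` (at `N = 1`, `L₂ − L₁ = g(1−s)W ≥ 0`)
    have hL1 : g * (1 * ((1 - W) ^ 2 * (1 - s) + W * (1 - W * (1 - s))) - W) +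
        (1 * p * ((1 - W) * (1 - r * s) + W * (1 - r)) - W * (1 - p * r)) * (1 - g) < 0 := by
      by_contra hc1
      have h1 : 0 ≤ g * (1 * ((1 - W) ^ 2 * (1 - s) + W * (1 - W * (1 - s))) - W) +
          (1 * p * ((1 - W) * (1 - r * s) + W * (1 - r)) - W * (1 - p * r)) * (1 - g) := le_of_not_gt hc1
      apply hL
      refine ⟨h1, ?_⟩
      have e : 1 * g * (1 - W) * (1 - s) + (1 * p * ((1 - W) * (1 - r * s) + W * (1 - r)) - W * (1 - p * r)) * (1 - g) =
          (g * (1 * ((1 - W) ^ 2 * (1 - s) + W * (1 - W * (1 - s))) - W) +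
            (1 * p * ((1 - W) * (1 - r * s) + W * (1 - r)) - W * (1 - p * r)) * (1 - g)) + g * ((1 - s) * W) := by ring
      rw [e]
      have : 0 ≤ g * ((1 - s) * W) := mul_nonneg hg0 (mul_nonneg (by linarith) hW0)
      linarith
    by_cases hglt : g < 1
    · obtain ⟨hZ00, hZ01, hZA1⟩ := cover_Z hp0 hp1 hr0 hr1 hs0 hs1 hW hg0 hg1 hA1' hL1
      have hlam : 0 ≤ (1 - s) * (1 - W) + s * W := add_nonneg (mul_nonneg (by linarith) (by linarith)) (mul_nonneg hs0 hW0)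
      exact arith_M3one hW hx00 hx01 ha1 hone hg hglt hP hqv hqh hSubd hlam hZ00 hZ01 hZA1 hxv hSub hEN
    · -- the corner `g = 1`: all mass on `c, d₁`
      have hg1' : g = 1 := le_antisymm hg1 (le_of_not_gt hglt)
      have hsum0 : x00 + x01 + a1 = 0 := by rw [hg] at hg1'; linarith
      have e00 : x00 = 0 := by linarith
      have e01 : x01 = 0 := by linarith
      have ea1 : a1 = 0 := by linarith
      have hone' : c + d1 = 1 := by rw [hg] at hg1'; exact hg1'
      have hP' : P = (1 - W) * s * c + (1 - W * (1 - s)) * d1 := by rw [hP, e00, e01, ea1]; ring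
      have hqv' : qv = p + (1 - p) * r * 1 := by rw [hqv, hg1']
      have hqh' : qh = s * (p * r + (1 - p * r) * 1) := by rw [hqh, hg1']
      have hSubd' : Sub = d1 := by rw [hSubd, e01, ea1]; ring
      -- at `g = 1`: `L₁ = (1−s)(1−2W) < 0`, so `2W − 1 > 0`
      have hq : 0 ≤ 2 * ((1 - p) * (1 - r)) - 1 := by
        rw [hg1'] at hL1
        have e : 1 * (1 * ((1 - W) ^ 2 * (1 - s) + W * (1 - W * (1 - s))) - W) +
            (1 * p * ((1 - W) * (1 - r * s) + W * (1 - r)) - W * (1 - p * r)) * (1 - 1) = (1 - s) * (1 - 2 * W) := by ring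
        rw [e] at hL1
        rw [← hW]
        by_contra hc
        have : 0 ≤ (1 - s) * (1 - 2 * W) := mul_nonneg (by linarith) (by linarith [le_of_not_ge hc])
        linarith
      have hLam : 0 < W + (1 - s) := by rw [hW]; linarith
      have hI := box_I7d hp0 hp1 hr0 hr1 hs0 hs1 hq
      rw [← hW] at hI
      have hI' : 0 ≤ (W + (1 - s)) * s * W - (1 - s) * (1 - W) * (s - W) := by linarith
      exact arith_M3top hW hW1 hs1 hLam hd1 hone' hP' hqv' hqh' hSubd' hI' hxv hSub hEN

end EarHair

end Quant

end Summit.CriticalPhenomena.PercolationContinuityZ3.Theorems
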